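import Literature.Topology.FourManifolds.SimplifiedBrokenLefschetzSidesGenus
import Literature.Topology.FourManifolds.TorusCoordinates
import HarnessLib

/-!
# Vocabulary of the slice-gluing proof of `SblfDescent.RungOne`
(crux `RungOne`, item stmt-SmoothPoincare4-18531, line `Sketch`, lead reshape 5)

The apex stub `stub_sliceGluing` (the complement `K = {⟪f, v⟫ ≥ -1/2}` of the sphere tube of a
genus-one Lefschetz-free simplified broken Lefschetz fibration on a closed simply connected `X`
is the polar tube `V₀ ≅ S¹ × B³`, fibrewise on the boundary) is proved in the skeleton
`Cruxes/RungOne/Lines/Sketch.lean` from registered bricks.  This file only DECLARES the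
`Prop`-valued vocabulary shared by those bricks, so that their registered signatures stay short:

* `rigidDir σ θ u` — the unit vector `R(-θ) (u₀, σ u₁)` of `ℝ²` (the rigid value of the torus
  angular coordinate on the vanishing annulus: longitude `u`, conjugated by the sign `σ = ±1`,
  rotated back by the depth angle `θ = g(x₂)`);
* `IsFoldTube f v ε ν` — the `S¹`-parametric fold normal form of the round circle (conclusion of
  the brick `helper_sliceGluing_foldNormalForm`): `ν : S¹ × ℝ³ → X` is a tube about the round
  locus on which `f ∘ ν (u, x) = (√(1 - Q²) u, v₂ Q)`, `Q = x₀² + x₁² - x₂²`;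
* `IsRigidCollar f v ν σ g s₁ s₂ ε₂ ιC aC bC` — rigid torus coordinates on the band
  `{s₁ < ⟪f, v⟫ < s₂}` matched to the tube (conclusion of `helper_sliceGluing_rigidCollar`);
* `IsTorusAngular f v ν σ sA sB ε₂ A` — a fibrewise-submersive circle-valued map on the torus
  region matched to the tube with `g = arctan` (conclusion of `helper_sliceGluing_torusAngular`);
* `IsTorusSideProduct f v ιT` — the torus side as a product `Fb × ℝ²`
  (`IsSimplifiedBrokenLefschetzFibration.exists_isSmoothEmbedding_prod_range_eq_preimage_hemisphere`
  applied to the pole `-v`).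

References: Auroux–Donaldson–Katzarkov, Geom. Topol. 9 (2005), §8.2 Ex. 1
[AurouxDonaldsonKatzarkov2005]; Baykur–Kamada, J. Math. Soc. Japan 67 (2015), §2, §5
[BaykurKamada2015]; Hayano, Algebr. Geom. Topol. 11 (2011), Def. 2.1 (4) [Hayano2011].
-/

noncomputable section

set_option linter.dupNamespace false

namespace Summit.SmoothPoincare4.SmoothPoincare4.Cruxes.RungOne.Sketch

open Set Function
open scoped _root_.Manifold _root_.ContDiff _root_.Topology RealInnerProductSpace
open Literature.Topology.FourManifolds

attribute [local instance] Literature.Topology.FourManifolds.fact_finrank_euclideanSpace_succ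

/-! ## The rigid direction -/

/-- The unit vector `R(-θ) (u₀, σ u₁)` of `ℝ²`: coordinates
`(cos θ · u₀ + σ sin θ · u₁, -sin θ · u₀ + σ cos θ · u₁)`. -/
def rigidDir (σ θ : ℝ) (u : Metric.sphere (0 : EuclideanSpace ℝ (Fin 2)) 1) :
    EuclideanSpace ℝ (Fin 2) :=
  (EuclideanSpace.equiv (Fin 2) ℝ).symm
    ![Real.cos θ * (u : EuclideanSpace ℝ (Fin 2)) 0 + σ * Real.sin θ * (u : EuclideanSpace ℝ (Fin 2)) 1,
      -Real.sin θ * (u : EuclideanSpace ℝ (Fin 2)) 0 + σ * Real.cos θ * (u : EuclideanSpace ℝ (Fin 2)) 1]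

/-- First coordinate of `rigidDir`. -/
@[simp]
theorem rigidDir_apply_zero (σ θ : ℝ) (u : Metric.sphere (0 : EuclideanSpace ℝ (Fin 2)) 1) :
    rigidDir σ θ u 0 =
      Real.cos θ * (u : EuclideanSpace ℝ (Fin 2)) 0 + σ * Real.sin θ * (u : EuclideanSpace ℝ (Fin 2)) 1 := by
  simp [rigidDir]

/-- Second coordinate of `rigidDir`. -/
@[simp]
theorem rigidDir_apply_one (σ θ : ℝ) (u : Metric.sphere (0 : EuclideanSpace ℝ (Fin 2)) 1) :
    rigidDir σ θ u 1 =
      -Real.sin θ * (u : EuclideanSpace ℝ (Fin 2)) 0 + σ * Real.cos θ * (u : EuclideanSpace ℝ (Fin 2)) 1 := by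
  simp [rigidDir]

section Tube

variable {X : Type} [TopologicalSpace X] [ChartedSpace (EuclideanSpace ℝ (Fin 4)) X]

/-- **The `S¹`-parametric fold normal form of the round circle** (the conclusion of the brick
`helper_sliceGluing_foldNormalForm`, as a predicate on `(ε, ν)`): `0 < ε < 1`; `ν` is `C^∞`,
injective, with open image and injective differential on `S¹ × B(0, ε)`; its zero section is
exactly the round locus of `f`; and `f (ν (u, x)) = (√(1 - Q²) u₀, √(1 - Q²) u₁, v₂ Q)` with
`Q = x₀² + x₁² - x₂²`. [cite: Hayano2011, Def. 2.1 (4)] -/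
structure IsFoldTube (f : X → Metric.sphere (0 : EuclideanSpace ℝ (Fin 3)) 1)
    (v : Metric.sphere (0 : EuclideanSpace ℝ (Fin 3)) 1) (ε : ℝ)
    (ν : (Metric.sphere (0 : EuclideanSpace ℝ (Fin 2)) 1) × EuclideanSpace ℝ (Fin 3) → X) : Prop where
  pos : 0 < ε
  lt_one : ε < 1
  contMDiffOn : ContMDiffOn ((𝓡 1).prod 𝓘(ℝ, EuclideanSpace ℝ (Fin 3))) (𝓡 4) ∞ ν (Set.univ ×ˢ Metric.ball 0 ε)
  injOn : Set.InjOn ν (Set.univ ×ˢ Metric.ball 0 ε)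
  isOpen : IsOpen (ν '' (Set.univ ×ˢ Metric.ball 0 ε))
  mfderiv_injective : ∀ p : (Metric.sphere (0 : EuclideanSpace ℝ (Fin 2)) 1) × EuclideanSpace ℝ (Fin 3),
    p.2 ∈ Metric.ball (0 : EuclideanSpace ℝ (Fin 3)) ε →
    Function.Injective (mfderiv ((𝓡 1).prod 𝓘(ℝ, EuclideanSpace ℝ (Fin 3))) (𝓡 4) ν p)
  round_iff : ∀ q : X, ¬ Surjective (mfderiv (𝓡 4) (𝓡 2) f q) ↔ ∃ u, ν (u, 0) = q
  formula : ∀ (u : Metric.sphere (0 : EuclideanSpace ℝ (Fin 2)) 1) (x : EuclideanSpace ℝ (Fin 3)),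
    x ∈ Metric.ball (0 : EuclideanSpace ℝ (Fin 3)) ε →
    ((f (ν (u, x)) : Metric.sphere (0 : EuclideanSpace ℝ (Fin 3)) 1) : EuclideanSpace ℝ (Fin 3)) 0 =
        √(1 - (x 0 ^ 2 + x 1 ^ 2 - x 2 ^ 2) ^ 2) * (u : EuclideanSpace ℝ (Fin 2)) 0 ∧
    ((f (ν (u, x)) : Metric.sphere (0 : EuclideanSpace ℝ (Fin 3)) 1) : EuclideanSpace ℝ (Fin 3)) 1 =
        √(1 - (x 0 ^ 2 + x 1 ^ 2 - x 2 ^ 2) ^ 2) * (u : EuclideanSpace ℝ (Fin 2)) 1 ∧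
    ((f (ν (u, x)) : Metric.sphere (0 : EuclideanSpace ℝ (Fin 3)) 1) : EuclideanSpace ℝ (Fin 3)) 2 =
        (v : EuclideanSpace ℝ (Fin 3)) 2 * (x 0 ^ 2 + x 1 ^ 2 - x 2 ^ 2)

/-- **Rigid torus coordinates on a collar band, matched to the fold tube** (the conclusion of
the brick `helper_sliceGluing_rigidCollar`, as a predicate): on the band `{s₁ < ⟪f, v⟫ < s₂}`
(`0 < s₁ < s₂ < ε₂² / 4`), `ιC ((a, b), (u, s))` is the point of the fibre over the base point
of longitude `u` and height `s` with fibre coordinates `(a, b) ∈ S¹ × S¹`, with smooth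
retractions `aC`, `bC`, and on the tube the angular coordinate is rigid:
`aC (ν (u, x)) = rigidDir σ (g (x₂)) u`. [cite: BaykurKamada2015, §2] -/
structure IsRigidCollar (f : X → Metric.sphere (0 : EuclideanSpace ℝ (Fin 3)) 1)
    (v : Metric.sphere (0 : EuclideanSpace ℝ (Fin 3)) 1)
    (ν : (Metric.sphere (0 : EuclideanSpace ℝ (Fin 2)) 1) × EuclideanSpace ℝ (Fin 3) → X)
    (σ : ℝ) (g : ℝ → ℝ) (s₁ s₂ ε₂ : ℝ)
    (ιC : ((Metric.sphere (0 : EuclideanSpace ℝ (Fin 2)) 1) × (Metric.sphere (0 : EuclideanSpace ℝ (Fin 2)) 1)) × ((Metric.sphere (0 : EuclideanSpace ℝ (Fin 2)) 1) × ℝ) → X)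
    (aC bC : X → Metric.sphere (0 : EuclideanSpace ℝ (Fin 2)) 1) : Prop where
  pos : 0 < s₁
  lt : s₁ < s₂
  ε₂_pos : 0 < ε₂
  lt_sq : s₂ < ε₂ ^ 2 / 4
  contMDiffOn : ContMDiffOn (((𝓡 1).prod (𝓡 1)).prod ((𝓡 1).prod 𝓘(ℝ, ℝ))) (𝓡 4) ∞ ιC
    (Set.univ ×ˢ (Set.univ ×ˢ Set.Ioo s₁ s₂))
  formula : ∀ (a b u : Metric.sphere (0 : EuclideanSpace ℝ (Fin 2)) 1) (s : ℝ), s₁ < s → s < s₂ →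
    ((f (ιC ((a, b), (u, s))) : Metric.sphere (0 : EuclideanSpace ℝ (Fin 3)) 1) : EuclideanSpace ℝ (Fin 3)) 0 = √(1 - s ^ 2) * (u : EuclideanSpace ℝ (Fin 2)) 0 ∧
    ((f (ιC ((a, b), (u, s))) : Metric.sphere (0 : EuclideanSpace ℝ (Fin 3)) 1) : EuclideanSpace ℝ (Fin 3)) 1 = √(1 - s ^ 2) * (u : EuclideanSpace ℝ (Fin 2)) 1 ∧
    ((f (ιC ((a, b), (u, s))) : Metric.sphere (0 : EuclideanSpace ℝ (Fin 3)) 1) : EuclideanSpace ℝ (Fin 3)) 2 = (v : EuclideanSpace ℝ (Fin 3)) 2 * s ∧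
    aC (ιC ((a, b), (u, s))) = a ∧ bC (ιC ((a, b), (u, s))) = b
  contMDiffOn_aC : ContMDiffOn (𝓡 4) (𝓡 1) ∞ aC {x | s₁ < (v : EuclideanSpace ℝ (Fin 3)) 2 * ((f x : Metric.sphere (0 : EuclideanSpace ℝ (Fin 3)) 1) : EuclideanSpace ℝ (Fin 3)) 2 ∧ (v : EuclideanSpace ℝ (Fin 3)) 2 * ((f x : Metric.sphere (0 : EuclideanSpace ℝ (Fin 3)) 1) : EuclideanSpace ℝ (Fin 3)) 2 < s₂}
  contMDiffOn_bC : ContMDiffOn (𝓡 4) (𝓡 1) ∞ bC {x | s₁ < (v : EuclideanSpace ℝ (Fin 3)) 2 * ((f x : Metric.sphere (0 : EuclideanSpace ℝ (Fin 3)) 1) : EuclideanSpace ℝ (Fin 3)) 2 ∧ (v : EuclideanSpace ℝ (Fin 3)) 2 * ((f x : Metric.sphere (0 : EuclideanSpace ℝ (Fin 3)) 1) : EuclideanSpace ℝ (Fin 3)) 2 < s₂}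
  section_eq : ∀ x : X, s₁ < (v : EuclideanSpace ℝ (Fin 3)) 2 * ((f x : Metric.sphere (0 : EuclideanSpace ℝ (Fin 3)) 1) : EuclideanSpace ℝ (Fin 3)) 2 → (v : EuclideanSpace ℝ (Fin 3)) 2 * ((f x : Metric.sphere (0 : EuclideanSpace ℝ (Fin 3)) 1) : EuclideanSpace ℝ (Fin 3)) 2 < s₂ →
    ∃ u : Metric.sphere (0 : EuclideanSpace ℝ (Fin 2)) 1, ιC ((aC x, bC x), (u, (v : EuclideanSpace ℝ (Fin 3)) 2 * ((f x : Metric.sphere (0 : EuclideanSpace ℝ (Fin 3)) 1) : EuclideanSpace ℝ (Fin 3)) 2)) = x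
  rigid : ∀ (u : Metric.sphere (0 : EuclideanSpace ℝ (Fin 2)) 1) (x : EuclideanSpace ℝ (Fin 3)), x ∈ Metric.ball (0 : EuclideanSpace ℝ (Fin 3)) ε₂ →
    s₁ < x 0 ^ 2 + x 1 ^ 2 - x 2 ^ 2 → x 0 ^ 2 + x 1 ^ 2 - x 2 ^ 2 < s₂ →
    ((aC (ν (u, x)) : Metric.sphere (0 : EuclideanSpace ℝ (Fin 2)) 1) : EuclideanSpace ℝ (Fin 2)) = rigidDir σ (g (x 2)) u

/-- **A torus angular map matched to the fold tube** (the conclusion of the brick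
`helper_sliceGluing_torusAngular` for one sign `σ`, with `g = arctan`, as a predicate):
`0 < sA < sB < ε₂² / 4`; `A` is `C^∞` on `{sA < ⟪f, v⟫}` (the polar torus fibre included),
fibrewise submersive there, and `A (ν (u, x)) = rigidDir σ (arctan x₂) u` on the tube part of
the band `{sA < Q < sB}`. [cite: BaykurKamada2015, §5] -/
structure IsTorusAngular (f : X → Metric.sphere (0 : EuclideanSpace ℝ (Fin 3)) 1)
    (v : Metric.sphere (0 : EuclideanSpace ℝ (Fin 3)) 1)
    (ν : (Metric.sphere (0 : EuclideanSpace ℝ (Fin 2)) 1) × EuclideanSpace ℝ (Fin 3) → X)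
    (σ sA sB ε₂ : ℝ) (A : X → Metric.sphere (0 : EuclideanSpace ℝ (Fin 2)) 1) : Prop where
  pos : 0 < sA
  lt : sA < sB
  ε₂_pos : 0 < ε₂
  lt_sq : sB < ε₂ ^ 2 / 4
  contMDiffOn : ContMDiffOn (𝓡 4) (𝓡 1) ∞ A {x | sA < (v : EuclideanSpace ℝ (Fin 3)) 2 * ((f x : Metric.sphere (0 : EuclideanSpace ℝ (Fin 3)) 1) : EuclideanSpace ℝ (Fin 3)) 2}
  submersive : ∀ x : X, sA < (v : EuclideanSpace ℝ (Fin 3)) 2 * ((f x : Metric.sphere (0 : EuclideanSpace ℝ (Fin 3)) 1) : EuclideanSpace ℝ (Fin 3)) 2 →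
    ∃ y : EuclideanSpace ℝ (Fin 4), mfderiv (𝓡 4) (𝓡 2) f x y = 0 ∧ mfderiv (𝓡 4) (𝓡 1) A x y ≠ 0
  rigid : ∀ (u : Metric.sphere (0 : EuclideanSpace ℝ (Fin 2)) 1) (x : EuclideanSpace ℝ (Fin 3)), x ∈ Metric.ball (0 : EuclideanSpace ℝ (Fin 3)) ε₂ →
    sA < x 0 ^ 2 + x 1 ^ 2 - x 2 ^ 2 → x 0 ^ 2 + x 1 ^ 2 - x 2 ^ 2 < sB →
    ((A (ν (u, x)) : Metric.sphere (0 : EuclideanSpace ℝ (Fin 2)) 1) : EuclideanSpace ℝ (Fin 2)) = rigidDir σ (Real.arctan (x 2)) u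

end Tube

section Side

variable {X : Type} [TopologicalSpace X] [ChartedSpace (EuclideanSpace ℝ (Fin 4)) X]
  {Fb : Type} [TopologicalSpace Fb] [ChartedSpace (EuclideanSpace ℝ (Fin 2)) Fb]

/-- **The torus side as a product** (the conclusion of
`IsSimplifiedBrokenLefschetzFibration.exists_isSmoothEmbedding_prod_range_eq_preimage_hemisphere`
at the pole `-v`, as a predicate on `ιT : Fb × ℝ² → X`): a smooth embedding onto the side
`{⟪f, -v⟫ < 0}` along which `f` depends on the base coordinate alone,
`f (ιT (θ, w)) = σ_{-v}⁻¹ (univBall 0 2 w)`, with central fibre `f⁻¹(v)` embedded by `ιT (·, 0)`.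
[cite: BaykurKamada2015, §2] -/
structure IsTorusSideProduct (f : X → Metric.sphere (0 : EuclideanSpace ℝ (Fin 3)) 1)
    (v : Metric.sphere (0 : EuclideanSpace ℝ (Fin 3)) 1) (ιT : Fb × EuclideanSpace ℝ (Fin 2) → X) : Prop where
  isSmoothEmbedding : Manifold.IsSmoothEmbedding ((𝓡 2).prod (𝓡 2)) (𝓡 4) ∞ ιT
  range_eq : range ιT = f ⁻¹' {y | ⟪(y : EuclideanSpace ℝ (Fin 3)), ((-v : Metric.sphere (0 : EuclideanSpace ℝ (Fin 3)) 1) : EuclideanSpace ℝ (Fin 3))⟫ < 0}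
  isSmoothEmbedding_zero : Manifold.IsSmoothEmbedding (𝓡 2) (𝓡 4) ∞ (fun θ => ιT (θ, 0))
  range_zero : range (fun θ => ιT (θ, 0)) = f ⁻¹' {-(-v)}
  formula : ∀ p, f (ιT p) = (stereographic' 2 (-v)).symm (OpenPartialHomeomorph.univBall (0 : EuclideanSpace ℝ (Fin 2)) 2 p.2)

end Side

end Summit.SmoothPoincare4.SmoothPoincare4.Cruxes.RungOne.Sketch

end

/-! ## Vocabulary of the construction brick F3 (lead reshape 7, 2026-08-17) -/

noncomputable section

set_option linter.dupNamespace false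

namespace Summit.SmoothPoincare4.SmoothPoincare4.Cruxes.RungOne.Sketch

open Set Function
open scoped _root_.Manifold _root_.ContDiff _root_.Topology RealInnerProductSpace
open Literature.Topology.FourManifolds

attribute [local instance] Literature.Topology.FourManifolds.fact_finrank_euclideanSpace_succ

section Transport

variable {X : Type} [TopologicalSpace X] [ChartedSpace (EuclideanSpace ℝ (Fin 4)) X]

/-- **The transported torus angular coordinate** (output of the layer `helper_f3_transport` of
brick F3, as designed by its worker): an `S¹`-valued `a` on `{-σ₅ < ⟪f, v⟫}`, smooth, equal to
the torus angular map `A` on `{σ₀ ≤ ⟪f, v⟫}`, given by the rigid formula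
`a (ν (u, y)) = rigidDir σ (arctan y₂) u` on the FORMULA REGION `ν (S¹ × {|y| < εT, y₂² < β})`
(which contains the sphere-side axis down to height `-σ₅`), fibrewise submersive off that
region, and with the LEVEL PROPERTY: below height `0`, `a x = (f₀, σ f₁)/‖·‖` forces `x` onto the
core surface `ν (S¹ × {y₂ = 0})`. [cite: BaykurKamada2015, §5] -/
structure IsTransportedAngle (f : X → Metric.sphere (0 : EuclideanSpace ℝ (Fin 3)) 1) (v : Metric.sphere (0 : EuclideanSpace ℝ (Fin 3)) 1)
    (ν : (Metric.sphere (0 : EuclideanSpace ℝ (Fin 2)) 1) × EuclideanSpace ℝ (Fin 3) → X) (σ sA sB ε₂ : ℝ) (A : X → Metric.sphere (0 : EuclideanSpace ℝ (Fin 2)) 1)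
    (σ₀ σ₅ εT β : ℝ) (a : X → Metric.sphere (0 : EuclideanSpace ℝ (Fin 2)) 1) : Prop where
  lt_σ₀ : sA < σ₀
  σ₀_lt : σ₀ < sB
  σ₅_pos : 0 < σ₅
  σ₅_lt : σ₅ < β
  two_mul_lt : 2 * σ₅ < εT ^ 2
  εT_pos : 0 < εT
  εT_le : εT ≤ ε₂
  sq_le : εT ^ 2 ≤ sB
  contMDiffOn : ContMDiffOn (𝓡 4) (𝓡 1) ∞ a {x | -σ₅ < (v : EuclideanSpace ℝ (Fin 3)) 2 * ((f x : Metric.sphere (0 : EuclideanSpace ℝ (Fin 3)) 1) : EuclideanSpace ℝ (Fin 3)) 2}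
  eq_of_le : ∀ x : X, σ₀ ≤ (v : EuclideanSpace ℝ (Fin 3)) 2 * ((f x : Metric.sphere (0 : EuclideanSpace ℝ (Fin 3)) 1) : EuclideanSpace ℝ (Fin 3)) 2 → a x = A x
  formula : ∀ (u : Metric.sphere (0 : EuclideanSpace ℝ (Fin 2)) 1) (y : EuclideanSpace ℝ (Fin 3)), y ∈ Metric.ball (0 : EuclideanSpace ℝ (Fin 3)) εT → y 2 ^ 2 < β →
    ((a (ν (u, y)) : Metric.sphere (0 : EuclideanSpace ℝ (Fin 2)) 1) : EuclideanSpace ℝ (Fin 2)) = rigidDir σ (Real.arctan (y 2)) u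
  submersive : ∀ x : X, -σ₅ < (v : EuclideanSpace ℝ (Fin 3)) 2 * ((f x : Metric.sphere (0 : EuclideanSpace ℝ (Fin 3)) 1) : EuclideanSpace ℝ (Fin 3)) 2 →
    (∀ (u : Metric.sphere (0 : EuclideanSpace ℝ (Fin 2)) 1) (y : EuclideanSpace ℝ (Fin 3)), y ∈ Metric.ball (0 : EuclideanSpace ℝ (Fin 3)) εT → y 2 ^ 2 < β → ν (u, y) ≠ x) →
    ∃ w : EuclideanSpace ℝ (Fin 4), mfderiv (𝓡 4) (𝓡 2) f x w = 0 ∧ mfderiv (𝓡 4) (𝓡 1) a x w ≠ 0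
  level : ∀ x : X, -σ₅ < (v : EuclideanSpace ℝ (Fin 3)) 2 * ((f x : Metric.sphere (0 : EuclideanSpace ℝ (Fin 3)) 1) : EuclideanSpace ℝ (Fin 3)) 2 → (v : EuclideanSpace ℝ (Fin 3)) 2 * ((f x : Metric.sphere (0 : EuclideanSpace ℝ (Fin 3)) 1) : EuclideanSpace ℝ (Fin 3)) 2 ≤ 0 →
    ((a x : Metric.sphere (0 : EuclideanSpace ℝ (Fin 2)) 1) : EuclideanSpace ℝ (Fin 2)) 0 * √(((f x : Metric.sphere (0 : EuclideanSpace ℝ (Fin 3)) 1) : EuclideanSpace ℝ (Fin 3)) 0 ^ 2 + ((f x : Metric.sphere (0 : EuclideanSpace ℝ (Fin 3)) 1) : EuclideanSpace ℝ (Fin 3)) 1 ^ 2) =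
      ((f x : Metric.sphere (0 : EuclideanSpace ℝ (Fin 3)) 1) : EuclideanSpace ℝ (Fin 3)) 0 →
    ((a x : Metric.sphere (0 : EuclideanSpace ℝ (Fin 2)) 1) : EuclideanSpace ℝ (Fin 2)) 1 * √(((f x : Metric.sphere (0 : EuclideanSpace ℝ (Fin 3)) 1) : EuclideanSpace ℝ (Fin 3)) 0 ^ 2 + ((f x : Metric.sphere (0 : EuclideanSpace ℝ (Fin 3)) 1) : EuclideanSpace ℝ (Fin 3)) 1 ^ 2) =
      σ * ((f x : Metric.sphere (0 : EuclideanSpace ℝ (Fin 3)) 1) : EuclideanSpace ℝ (Fin 3)) 1 →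
    ∃ (u : Metric.sphere (0 : EuclideanSpace ℝ (Fin 2)) 1) (y : EuclideanSpace ℝ (Fin 3)), y ∈ Metric.ball (0 : EuclideanSpace ℝ (Fin 3)) εT ∧ y 2 = 0 ∧ ν (u, y) = x

end Transport

section Bott

variable {X : Type} [TopologicalSpace X] [ChartedSpace (EuclideanSpace ℝ (Fin 4)) X]

/-- **A Morse–Bott datum for the complement of the sphere tube** (the conclusion of brick F =
`helper_sliceGluing_bottFunction` and of F3, as a predicate = the input format of the fibred
Morse–Bott recognition brick R): `F` with regular level `a`, `{a ≤ F} = {-1/2 ≤ ⟪f, v⟫}`, whose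
critical set in `{a ≤ F}` is the Bott-nondegenerate maximum circle `e (S¹)` at level `b`; a unit
angular map `α`, smooth on `{a' < F}`, with `α ∘ e = id` and `(F, α)` a submersion off the circle;
and on `∂K` the angular map is `√2 · w` in the sphere-side coordinate `ιX (θ, w)`.
[cite: Milnor1963, §2] [cite: BanyagaHurtubise2004, Thm. 2] -/
structure IsBottDatum (f : X → Metric.sphere (0 : EuclideanSpace ℝ (Fin 3)) 1) (v : Metric.sphere (0 : EuclideanSpace ℝ (Fin 3)) 1) (ιX : (Metric.sphere (0 : EuclideanSpace ℝ (Fin 3)) 1) × EuclideanSpace ℝ (Fin 2) → X)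
    (F : X → ℝ) (a' a b : ℝ) (e : (Metric.sphere (0 : EuclideanSpace ℝ (Fin 2)) 1) → X) (α : X → EuclideanSpace ℝ (Fin 2)) : Prop where
  lt : a' < a
  lt' : a < b
  isRegularLevel : IsRegularLevel (𝓡 4) F a
  isSmoothEmbedding : Manifold.IsSmoothEmbedding (𝓡 1) (𝓡 4) ∞ e
  le : ∀ x, a ≤ F x → F x ≤ b
  crit_iff : ∀ x, a ≤ F x → (IsMCriticalPt (𝓡 4) F x ↔ x ∈ range e)
  apply_e : ∀ u, F (e u) = b
  bott : ∀ (u : Metric.sphere (0 : EuclideanSpace ℝ (Fin 2)) 1) (w : EuclideanSpace ℝ (Fin 4)), mhessian (𝓡 4) F (e u) w w ≤ 0 ∧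
    (mhessian (𝓡 4) F (e u) w w = 0 → w ∈ range (mfderiv (𝓡 1) (𝓡 4) e u))
  contMDiffOn_α : ContMDiffOn (𝓡 4) 𝓘(ℝ, EuclideanSpace ℝ (Fin 2)) ∞ α {x | a' < F x}
  norm_α : ∀ x, a' < F x → ‖α x‖ = 1
  α_e : ∀ u : Metric.sphere (0 : EuclideanSpace ℝ (Fin 2)) 1, α (e u) = (u : EuclideanSpace ℝ (Fin 2))
  submersion : ∀ x, a ≤ F x → x ∉ range e → ∀ (r : ℝ) (w : EuclideanSpace ℝ (Fin 2)), ⟪w, α x⟫ = 0 →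
    ∃ y : EuclideanSpace ℝ (Fin 4), mfderiv (𝓡 4) 𝓘(ℝ, ℝ) F x y = r ∧ mfderiv (𝓡 4) 𝓘(ℝ, EuclideanSpace ℝ (Fin 2)) α x y = w
  preimage_eq : (fun y => (-1 / 2 : ℝ) - (SphereHeight.height (v : EuclideanSpace ℝ (Fin 3)) ∘ f) y) ⁻¹' Set.Iic 0 =
    (fun y => a - F y) ⁻¹' Set.Iic 0
  apply_eq_of : ∀ x, (SphereHeight.height (v : EuclideanSpace ℝ (Fin 3)) ∘ f) x = -1 / 2 → F x = a
  boundary : ∀ p : (Metric.sphere (0 : EuclideanSpace ℝ (Fin 3)) 1) × EuclideanSpace ℝ (Fin 2), (SphereHeight.height (v : EuclideanSpace ℝ (Fin 3)) ∘ f) (ιX p) = -1 / 2 →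
    α (ιX p) = (√2 : ℝ) • p.2 ∧ ‖p.2‖ ^ 2 = 1 / 2

end Bott

end Summit.SmoothPoincare4.SmoothPoincare4.Cruxes.RungOne.Sketch

end
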